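import Summits.RiemannHypothesis.RiemannHypothesis.Theorems.ZetaScrewCuspSecondOrder
import HarnessLib

/-!
# RH-FREE: the `1/M` drift of the top second difference of Suzuki's `Ψ`, `M·Δ²Ψ_top = log 2 − (7/4 − log 2)/M + O(1/M²)`

For `M ≥ 8` (`abs_topSecondDiff_mul_sub_log_two_add_le`; `∃ C` form `psiDefTopLaw₂`):

  `|M·(Ψ(log(M/(M−1))) + Ψ(log((M−1)/(M−2))) − Ψ(log(M/(M−2)))) − log 2 + (7/4 − log 2)/M| ≤ 22/M²`.

The DRIFT COEFFICIENT `7/4 − log 2 = 1.0569…` is identified; it refines `ZetaScrewTopSecondDifference`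
(`… = log 2 + O(1/M)`) and matches the screw column's measured approach (sos-theory, ADDENDUM B §B1 of the P3
theory: `M·Δ²Ψ_top = 0.6573, 0.6759, 0.6847, 0.6890, 0.6914` at `M = 32, 64, 128, 256, 600`, against
`log 2 − 1.0569/M = 0.6601, 0.6766, 0.6849, 0.6890, 0.6913`; the true residual is `≈ −2.7/M²`, the constant
`22` is generous).  Ingredients: the second-order cusp expansion `Ψ(t) = (t/2)log(1/t) + c·t + (7/8)t² + O(t³)`
(`ZetaScrewCuspSecondOrder.abs_zetaScrew_sub_cusp₂_le`, remainder `≤ t³/3`) at `a = log(M/(M−1))`,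
`b = log((M−1)/(M−2))` and `a + b = log(M/(M−2))`; the entropy defect
`−(b−a)²/(a+b) ≤ a·log((a+b)/(2a)) + b·log((a+b)/(2b)) ≤ 0` (`entropyDefect_bounds`, from
`1 − 1/u ≤ log u ≤ u − 1`); the cubic bracket `|log(m/(m−2)) − 2/m − 2/m²| ≤ (32/3)/m³`
(`abs_log_div_sub_two_sub_le`, `Real.abs_log_sub_add_sum_range_le`); and the cross term `−(7/4)·a·b` of the
`(7/8)t²` coefficient, which carries the drift: with `x = 1/M` the four pieces are bounded by `4x²`, `2x²`,
`8x²`, `8x²`.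

RH-FREE: statements about the explicit archimedean part of Suzuki2023 (1.1) near `0`; nothing here bears on
the truth of RH.  References: M. Suzuki, J. Lond. Math. Soc. (2) 108 (2023) [Suzuki2023]; [folklore].
-/

set_option linter.dupNamespace false
set_option autoImplicit false

noncomputable section

open Real Set

namespace Summit.RiemannHypothesis.RiemannHypothesis.Theorems.IntegerScrew

open Literature.NumberTheory.LFunctions

/-! ## Second-order bookkeeping lemmas for the top law -/

/-- Entropy defect of the two-point distribution `(a, b)/(a+b)` against the uniform one, in the form
`−(b−a)²/(a+b) ≤ a·log((a+b)/(2a)) + b·log((a+b)/(2b)) ≤ 0` (`1 − 1/u ≤ log u ≤ u − 1`). [folklore] -/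
theorem entropyDefect_bounds {a b : ℝ} (ha : 0 < a) (hb : 0 < b) :
    -(b - a) ^ 2 / (a + b) ≤ a * (Real.log (a + b) - Real.log a - Real.log 2)
        + b * (Real.log (a + b) - Real.log b - Real.log 2)
      ∧ a * (Real.log (a + b) - Real.log a - Real.log 2)
        + b * (Real.log (a + b) - Real.log b - Real.log 2) ≤ 0 := by
  have hs : 0 < a + b := by linarith
  have hxa : 0 < (a + b) / (2 * a) := by positivity
  have hxb : 0 < (a + b) / (2 * b) := by positivity
  have hla : Real.log ((a + b) / (2 * a)) = Real.log (a + b) - Real.log a - Real.log 2 := by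
    rw [Real.log_div hs.ne' (by positivity), Real.log_mul (by norm_num) ha.ne']; ring
  have hlb : Real.log ((a + b) / (2 * b)) = Real.log (a + b) - Real.log b - Real.log 2 := by
    rw [Real.log_div hs.ne' (by positivity), Real.log_mul (by norm_num) hb.ne']; ring
  rw [← hla, ← hlb]
  constructor
  · have h1 := Real.one_sub_inv_le_log_of_pos hxa
    have h2 := Real.one_sub_inv_le_log_of_pos hxb
    rw [inv_div] at h1 h2
    have e : a * (1 - 2 * a / (a + b)) + b * (1 - 2 * b / (a + b)) = -(b - a) ^ 2 / (a + b) := by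
      field_simp
      ring
    have h3 : a * (1 - 2 * a / (a + b)) ≤ a * Real.log ((a + b) / (2 * a)) :=
      mul_le_mul_of_nonneg_left h1 ha.le
    have h4 : b * (1 - 2 * b / (a + b)) ≤ b * Real.log ((a + b) / (2 * b)) :=
      mul_le_mul_of_nonneg_left h2 hb.le
    linarith
  · have h1 := Real.log_le_sub_one_of_pos hxa
    have h2 := Real.log_le_sub_one_of_pos hxb
    have e : a * ((a + b) / (2 * a) - 1) + b * ((a + b) / (2 * b) - 1) = 0 := by
      field_simp
      ring
    have h3 : a * Real.log ((a + b) / (2 * a)) ≤ a * ((a + b) / (2 * a) - 1) :=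
      mul_le_mul_of_nonneg_left h1 ha.le
    have h4 : b * Real.log ((a + b) / (2 * b)) ≤ b * ((a + b) / (2 * b) - 1) :=
      mul_le_mul_of_nonneg_left h2 hb.le
    linarith

/-- Cubic bracket of the top double gap: `|log(m/(m−2)) − 2/m − 2/m²| ≤ (32/3)/m³` for `m ≥ 8`
(`Real.abs_log_sub_add_sum_range_le` at `x = 2/m`, two terms). [folklore] -/
theorem abs_log_div_sub_two_sub_le {m : ℝ} (hm : 8 ≤ m) :
    |Real.log (m / (m - 2)) - 2 / m - 2 / m ^ 2| ≤ 32 / 3 / m ^ 3 := by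
  have hm0 : 0 < m := by linarith
  have hm2 : 0 < m - 2 := by linarith
  set x := 2 / m with hx
  have hx0 : 0 < x := by positivity
  have hx1 : x ≤ 1 / 4 := by rw [hx, div_le_iff₀ hm0]; linarith
  have hxabs : |x| < 1 := by rw [abs_of_pos hx0]; linarith
  have h := Real.abs_log_sub_add_sum_range_le hxabs 2
  simp only [Finset.sum_range_succ, Finset.sum_range_zero] at h
  norm_num at h
  rw [abs_of_pos hx0] at h
  have hlog : Real.log (m / (m - 2)) = -Real.log (1 - x) := by
    have e : 1 - x = (m - 2) / m := by rw [hx]; field_simp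
    rw [e, ← Real.log_inv, inv_div]
  have e1 : Real.log (m / (m - 2)) - 2 / m - 2 / m ^ 2 = -(x + x ^ 2 / 2 + Real.log (1 - x)) := by
    rw [hlog, hx]; ring
  rw [e1, abs_neg]
  have e2 : (32 : ℝ) / 3 / m ^ 3 = x ^ 3 / (3 / 4) := by rw [hx]; ring
  rw [e2]
  calc |x + x ^ 2 / 2 + Real.log (1 - x)| ≤ x ^ 3 / (1 - x) := h
    _ ≤ x ^ 3 / (3 / 4) := div_le_div_of_nonneg_left (by positivity) (by norm_num) (by linarith)

/-! ## The top second-difference law with its `1/M` drift -/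

set_option maxHeartbeats 400000 in
/-- **Top second-difference law, second order (RH-free, identified drift).** For `M ≥ 8`,
`|M·(Ψ(log(M/(M−1))) + Ψ(log((M−1)/(M−2))) − Ψ(log(M/(M−2)))) − log 2 + (7/4 − log 2)/M| ≤ 22/M²`.
With `a = log(M/(M−1)) ≤ b = log((M−1)/(M−2))`, `x = 1/M`: the pieces are
`((M(a+b)/2 − 1) − x)·log 2` (`≤ 4x²`, cubic log bracket), `(M/2)·(entropy defect)` (`≤ 2x²`),
`(7/4)(M·a·b − x)` (`∈ [0, 8x²]`) and the three `t³/3` remainders (`≤ 8x²`). [folklore] -/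
theorem abs_topSecondDiff_mul_sub_log_two_add_le {M : ℕ} (hM : 8 ≤ M) :
    |(zetaScrew (Real.log ((M : ℝ) / (M - 1))) + zetaScrew (Real.log (((M : ℝ) - 1) / (M - 2)))
        - zetaScrew (Real.log ((M : ℝ) / (M - 2)))) * M - Real.log 2
        + (7 / 4 - Real.log 2) / M| ≤ 22 / (M : ℝ) ^ 2 := by
  set m : ℝ := (M : ℝ) with hm
  have hm8 : (8 : ℝ) ≤ m := by rw [hm]; exact_mod_cast hM
  have hm0 : 0 < m := by linarith
  have hmne : m ≠ 0 := hm0.ne'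
  have hm1 : 0 < m - 1 := by linarith
  have hm2 : 0 < m - 2 := by linarith
  -- the three arguments
  set a := Real.log (m / (m - 1)) with ha
  set b := Real.log ((m - 1) / (m - 2)) with hb
  have hs : Real.log (m / (m - 2)) = a + b := by
    rw [ha, hb, ← Real.log_mul (by positivity) (by positivity)]
    congr 1
    field_simp
  have hL2 := abs_log_div_sub_two_sub_le hm8
  rw [hs] at hL2
  rw [hs]
  -- first-order brackets
  obtain ⟨ha_lo, ha_hi⟩ : 1 / m ≤ a ∧ a ≤ 1 / (m - 1) := log_div_sub_one_mem (m := m) (by linarith)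
  obtain ⟨hb_lo, hb_hi⟩ : 1 / (m - 1) ≤ b ∧ b ≤ 1 / (m - 2) := by
    have h := log_div_sub_one_mem (m := m - 1) (by linarith)
    have e2 : m - 1 - 1 = m - 2 := by ring
    rw [e2] at h
    exact h
  -- the small parameters `x = 1/m`, `e = 1/(m−2)`
  set x := 1 / m with hx
  set e := 1 / (m - 2) with he
  have hx0 : 0 < x := by positivity
  have he0 : 0 < e := by positivity
  have hx8 : x ≤ 1 / 8 := by rw [hx, div_le_div_iff₀ hm0 (by norm_num)]; linarith
  have he6 : e ≤ 1 / 6 := by rw [he, div_le_div_iff₀ hm2 (by norm_num)]; linarith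
  have hmx : m * x = 1 := by rw [hx]; field_simp
  have hem : m * e = 1 + 2 * e := by rw [he]; field_simp; ring
  have hex : e - x = 2 * x * e := by rw [he, hx]; field_simp; ring
  have he_x : e ≤ 4 / 3 * x := by
    rw [he, hx, div_le_iff₀ hm2]; field_simp; linarith
  have h1e : 1 / (m - 1) ≤ e := by rw [he, div_le_div_iff₀ hm1 hm2]; linarith
  have h1x : x ≤ 1 / (m - 1) := by rw [hx, div_le_div_iff₀ hm0 hm1]; linarith
  have hab : a ≤ b := le_trans ha_hi hb_lo
  have ha0 : 0 < a := lt_of_lt_of_le hx0 ha_lo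
  have hb0 : 0 < b := lt_of_lt_of_le ha0 hab
  have hae : a ≤ e := le_trans ha_hi h1e
  have hbe : b ≤ e := hb_hi
  have hbx : x ≤ b := le_trans ha_lo hab
  have hs0 : 0 < a + b := by linarith
  have hs2 : a + b ≤ 1 / 2 := by linarith
  have hsx : 2 * x ≤ a + b := by linarith
  -- the second-order cusp expansion at the three points
  set c := (1 - Real.eulerMascheroniConstant - Real.log (2 * Real.pi)) / 2 with hc
  set εa := zetaScrew a - (a / 2 * Real.log (1 / a) + c * a + 7 / 8 * a ^ 2) with hεa
  set εb := zetaScrew b - (b / 2 * Real.log (1 / b) + c * b + 7 / 8 * b ^ 2) with hεb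
  set εs := zetaScrew (a + b)
    - ((a + b) / 2 * Real.log (1 / (a + b)) + c * (a + b) + 7 / 8 * (a + b) ^ 2) with hεs
  have ra : |εa| ≤ a ^ 3 / 3 := abs_zetaScrew_sub_cusp₂_le ha0 (by linarith)
  have rb : |εb| ≤ b ^ 3 / 3 := abs_zetaScrew_sub_cusp₂_le hb0 (by linarith)
  have rs : |εs| ≤ (a + b) ^ 3 / 3 := abs_zetaScrew_sub_cusp₂_le hs0 hs2
  have hza : zetaScrew a = εa - a / 2 * Real.log a + c * a + 7 / 8 * a ^ 2 := by
    rw [hεa, one_div, Real.log_inv]; ring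
  have hzb : zetaScrew b = εb - b / 2 * Real.log b + c * b + 7 / 8 * b ^ 2 := by
    rw [hεb, one_div, Real.log_inv]; ring
  have hzs : zetaScrew (a + b)
      = εs - (a + b) / 2 * Real.log (a + b) + c * (a + b) + 7 / 8 * (a + b) ^ 2 := by
    rw [hεs, one_div, Real.log_inv]; ring
  -- the algebraic decomposition into four pieces
  set L := Real.log 2 with hL
  set Xab := a * (Real.log (a + b) - Real.log a - L) + b * (Real.log (a + b) - Real.log b - L)
    with hXab
  set ρ := a + b - 2 * x - 2 * x ^ 2 with hρ
  have key : (zetaScrew a + zetaScrew b - zetaScrew (a + b)) * m - L + (7 / 4 - L) / m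
      = L * (m / 2 * ρ) + m / 2 * Xab - 7 / 4 * (m * a * b - x) + m * (εa + εb - εs) := by
    rw [hza, hzb, hzs, hXab, hρ, hx]
    field_simp
    ring
  rw [key]
  -- the entropy defect, before the bodies of the abbreviations are forgotten
  obtain ⟨hX1, hX2⟩ := entropyDefect_bounds ha0 hb0
  rw [← hL, ← hXab] at hX1 hX2
  have hL0 : 0 < L := by rw [hL]; exact Real.log_pos one_lt_two
  have hL1 : L < 7 / 10 := by
    have := Real.log_two_lt_d9; rw [hL]; norm_num at this ⊢; linarith
  have hmx3 : m * x ^ 3 = x ^ 2 := by rw [hx]; field_simp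
  have hρ3 : |ρ| ≤ 32 / 3 * x ^ 3 := by
    have e1 : ρ = a + b - 2 / m - 2 / m ^ 2 := by rw [hρ, hx]; ring
    have e2 : (32 : ℝ) / 3 * x ^ 3 = 32 / 3 / m ^ 3 := by rw [hx]; ring
    rw [e1, e2]; exact hL2
  have e22 : (22 : ℝ) / m ^ 2 = 22 * x ^ 2 := by rw [hx]; field_simp
  rw [e22]
  -- forget `Ψ`, `log` and the cast: from here on everything is arithmetic in opaque reals
  clear key hza hzb hzs hL2 hs
  clear_value εa εb εs Xab ρ L c e x a b m
  -- piece 1: `|L·(m/2·ρ)| ≤ 4x²`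
  have hT1 : |L * (m / 2 * ρ)| ≤ 4 * x ^ 2 := by
    rw [abs_mul, abs_mul, abs_of_pos hL0, abs_of_pos (by positivity : (0 : ℝ) < m / 2)]
    have h1 : L * (m / 2 * |ρ|) ≤ 7 / 10 * (m / 2 * (32 / 3 * x ^ 3)) :=
      mul_le_mul hL1.le (mul_le_mul_of_nonneg_left hρ3 (by positivity)) (by positivity)
        (by norm_num)
    have e3 : 7 / 10 * (m / 2 * (32 / 3 * x ^ 3)) = 56 / 15 * (m * x ^ 3) := by ring
    rw [e3, hmx3] at h1
    have hx2 := sq_nonneg x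
    linarith
  -- piece 2: `|m/2·Xab| ≤ 2x²`
  have hT2 : |m / 2 * Xab| ≤ 2 * x ^ 2 := by
    have hd0 : 0 ≤ b - a := by linarith
    have hxe : 2 * x * e ≤ 2 * x * (4 / 3 * x) := mul_le_mul_of_nonneg_left he_x (by positivity)
    have hxe' : 2 * x * (4 / 3 * x) = 8 / 3 * x ^ 2 := by ring
    have hd1 : b - a ≤ 8 / 3 * x ^ 2 := by linarith
    have hd2 : (b - a) ^ 2 ≤ 64 / 9 * x ^ 4 := by
      calc (b - a) ^ 2 ≤ (8 / 3 * x ^ 2) ^ 2 := pow_le_pow_left₀ hd0 hd1 2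
        _ = 64 / 9 * x ^ 4 := by ring
    have hq1 : (b - a) ^ 2 / (a + b) ≤ (b - a) ^ 2 / (2 * x) :=
      div_le_div_of_nonneg_left (by positivity) (by positivity) hsx
    have hq2 : (b - a) ^ 2 / (2 * x) ≤ 64 / 9 * x ^ 4 / (2 * x) :=
      div_le_div_of_nonneg_right hd2 (by positivity)
    have e1 : 64 / 9 * x ^ 4 / (2 * x) = 32 / 9 * x ^ 3 := by
      field_simp
      ring
    have hq : (b - a) ^ 2 / (a + b) ≤ 32 / 9 * x ^ 3 := by linarith
    have hlo : m / 2 * (-(b - a) ^ 2 / (a + b)) ≤ m / 2 * Xab :=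
      mul_le_mul_of_nonneg_left hX1 (by positivity)
    have hup : m / 2 * Xab ≤ 0 := mul_nonpos_of_nonneg_of_nonpos (by positivity) hX2
    have e2 : m / 2 * (-(b - a) ^ 2 / (a + b)) = -(m / 2 * ((b - a) ^ 2 / (a + b))) := by ring
    have h3 : m / 2 * ((b - a) ^ 2 / (a + b)) ≤ m / 2 * (32 / 9 * x ^ 3) :=
      mul_le_mul_of_nonneg_left hq (by positivity)
    have e3 : m / 2 * (32 / 9 * x ^ 3) = 16 / 9 * (m * x ^ 3) := by ring
    rw [e3, hmx3] at h3
    have hx2 := sq_nonneg x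
    rw [abs_le]
    constructor
    · linarith
    · linarith
  -- piece 3: `0 ≤ 7/4·(m·a·b − x) ≤ 8x²`
  have hT3 : |7 / 4 * (m * a * b - x)| ≤ 8 * x ^ 2 := by
    have hlo : x ≤ m * a * b := by
      have h1 : m * x * x ≤ m * a * b :=
        mul_le_mul (mul_le_mul_of_nonneg_left ha_lo hm0.le) hbx hx0.le (by positivity)
      have e0 : m * x * x = x := by rw [hmx, one_mul]
      linarith
    have hhi : m * a * b ≤ x + 40 / 9 * x ^ 2 := by
      have h1 : m * a * b ≤ m * (1 / (m - 1)) * e :=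
        mul_le_mul (mul_le_mul_of_nonneg_left ha_hi hm0.le) hbe hb0.le (by positivity)
      have e1 : m * (1 / (m - 1)) = 1 + 1 / (m - 1) := by field_simp; ring
      rw [e1] at h1
      have h2 : (1 + 1 / (m - 1)) * e ≤ (1 + e) * e :=
        mul_le_mul_of_nonneg_right (by linarith) he0.le
      have h3 : (1 + e) * e = e + e ^ 2 := by ring
      have h4 : e ^ 2 ≤ 16 / 9 * x ^ 2 := by
        calc e ^ 2 ≤ (4 / 3 * x) ^ 2 := pow_le_pow_left₀ he0.le he_x 2
          _ = 16 / 9 * x ^ 2 := by ring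
      have hxe : 2 * x * e ≤ 2 * x * (4 / 3 * x) := mul_le_mul_of_nonneg_left he_x (by positivity)
      have hxe' : 2 * x * (4 / 3 * x) = 8 / 3 * x ^ 2 := by ring
      have h5 : e ≤ x + 8 / 3 * x ^ 2 := by linarith
      linarith
    rw [abs_of_nonneg (by linarith)]
    linarith
  -- piece 4: `|m(εa + εb − εs)| ≤ 8x²`
  have hT4 : |m * (εa + εb - εs)| ≤ 8 * x ^ 2 := by
    obtain ⟨ra1, ra2⟩ := abs_le.mp ra
    obtain ⟨rb1, rb2⟩ := abs_le.mp rb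
    obtain ⟨rs1, rs2⟩ := abs_le.mp rs
    have h1 : a ^ 3 ≤ e ^ 3 := pow_le_pow_left₀ ha0.le hae 3
    have h2 : b ^ 3 ≤ e ^ 3 := pow_le_pow_left₀ hb0.le hbe 3
    have h3 : (a + b) ^ 3 ≤ 8 * e ^ 3 := by
      calc (a + b) ^ 3 ≤ (2 * e) ^ 3 := pow_le_pow_left₀ hs0.le (by linarith) 3
        _ = 8 * e ^ 3 := by ring
    have hq : m * (a ^ 3 / 3 + b ^ 3 / 3 + (a + b) ^ 3 / 3) ≤ 8 * x ^ 2 := by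
      have h4 : m * (a ^ 3 / 3 + b ^ 3 / 3 + (a + b) ^ 3 / 3) ≤ m * (10 / 3 * e ^ 3) :=
        mul_le_mul_of_nonneg_left (by linarith) hm0.le
      have e1 : m * (10 / 3 * e ^ 3) = 10 / 3 * (m * e) * e ^ 2 := by ring
      have h5 : 10 / 3 * (m * e) * e ^ 2 ≤ 10 / 3 * (4 / 3) * e ^ 2 := by
        apply mul_le_mul_of_nonneg_right _ (sq_nonneg e)
        rw [hem]; linarith
      have h6 : e ^ 2 ≤ 16 / 9 * x ^ 2 := by
        calc e ^ 2 ≤ (4 / 3 * x) ^ 2 := pow_le_pow_left₀ he0.le he_x 2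
          _ = 16 / 9 * x ^ 2 := by ring
      have hx2 := sq_nonneg x
      calc m * (a ^ 3 / 3 + b ^ 3 / 3 + (a + b) ^ 3 / 3) ≤ m * (10 / 3 * e ^ 3) := h4
        _ = 10 / 3 * (m * e) * e ^ 2 := e1
        _ ≤ 10 / 3 * (4 / 3) * e ^ 2 := h5
        _ ≤ 10 / 3 * (4 / 3) * (16 / 9 * x ^ 2) := by gcongr
        _ ≤ 8 * x ^ 2 := by linarith
    have hup : m * (εa + εb - εs) ≤ m * (a ^ 3 / 3 + b ^ 3 / 3 + (a + b) ^ 3 / 3) :=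
      mul_le_mul_of_nonneg_left (by linarith) hm0.le
    have hlo : m * (-(a ^ 3 / 3 + b ^ 3 / 3 + (a + b) ^ 3 / 3)) ≤ m * (εa + εb - εs) :=
      mul_le_mul_of_nonneg_left (by linarith) hm0.le
    have e2 : m * (-(a ^ 3 / 3 + b ^ 3 / 3 + (a + b) ^ 3 / 3))
        = -(m * (a ^ 3 / 3 + b ^ 3 / 3 + (a + b) ^ 3 / 3)) := by ring
    rw [abs_le]
    constructor
    · linarith
    · linarith
  -- assemble
  have hsum : |L * (m / 2 * ρ) + m / 2 * Xab - 7 / 4 * (m * a * b - x) + m * (εa + εb - εs)|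
      ≤ |L * (m / 2 * ρ)| + |m / 2 * Xab| + |7 / 4 * (m * a * b - x)| + |m * (εa + εb - εs)| := by
    have e1 := abs_add_le (L * (m / 2 * ρ) + m / 2 * Xab - 7 / 4 * (m * a * b - x))
      (m * (εa + εb - εs))
    have e2 := abs_sub (L * (m / 2 * ρ) + m / 2 * Xab) (7 / 4 * (m * a * b - x))
    have e3 := abs_add_le (L * (m / 2 * ρ)) (m / 2 * Xab)
    linarith
  linarith

/-- The second-order top law in `∃ C` form: `M·Δ²Ψ_top(M) = log 2 − (7/4 − log 2)/M + O(1/M²)`. [folklore] -/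
theorem psiDefTopLaw₂ :
    ∃ C : ℝ, ∀ M : ℕ, 8 ≤ M →
      |(zetaScrew (Real.log ((M : ℝ) / (M - 1))) + zetaScrew (Real.log (((M : ℝ) - 1) / (M - 2)))
          - zetaScrew (Real.log ((M : ℝ) / (M - 2)))) * M - Real.log 2
          + (7 / 4 - Real.log 2) / M| ≤ C / (M : ℝ) ^ 2 :=
  ⟨22, fun _ hM => abs_topSecondDiff_mul_sub_log_two_add_le hM⟩

end Summit.RiemannHypothesis.RiemannHypothesis.Theorems.IntegerScrew

end
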